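import Summits.AtomisticToContinuum.Crystallization.Theses.PricedLinkCensus
import Summits.AtomisticToContinuum.Crystallization.Theorems.TruncatedCensusGap.Negative.KappaZeroHalf
import Summits.AtomisticToContinuum.Crystallization.Theorems.TruncatedCensusGap.Negative.WithoutInjective
import Summits.AtomisticToContinuum.Crystallization.Theorems.PricedLinkCensusTruncatedCensusGapNearOfLocalPricing
import Summits.AtomisticToContinuum.Crystallization.Theorems.PricedLinkCensusTruncatedCensusGapStrainedLinkDictionary
import Summits.AtomisticToContinuum.Crystallization.Theorems.PricedLinkCensusTruncatedCensusGapRatioGermEngine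
import Summits.AtomisticToContinuum.Crystallization.Theorems.PricedLinkCensusTruncatedCensusGapElasticBasinSplit

/-!
# Line `elastic-basin-split` — crux `PricedLinkCensus.TruncatedCensusGap` (stmt-AtomisticToContinuum-14230)

Crux strategist `planner-cstrat-stmt-AtomisticToContinuum-14230-s3-0` (2026-08-17), route
`route-AtomisticToContinuum-PricedLinkCensus`.  An ALTERNATIVE line: it coexists with the lead's
`Lines/birth.lean`, with strategist s2's `Lines/near_far_split.lean` and with the three idea lines,
and replaces none of them (published by `ledger crux write`; the item's live-skeleton pointer is
deliberately not re-registered).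

THE CUT (a RE-CUT of s2's near/far split at the ELASTIC-BASIN boundary).  s2 calls a site near when
its `3a`-patch is two-way `a/50`-matched to a RIGID Barlow stacking of scale `a ∈ [0.93, 1.02]` and
spacing `c ∈ [0.78a, 0.86a]`.  Here a site `i` of `y` is **near₂** when, for some Hägg word `s`,
some linear map `F` within `10 %` of `a₀ • id` (`a₀ = 977/1000`, the hcp* nearest-neighbour
distance; `‖F v − a₀ v‖ ≤ (a₀/10)‖v‖`) and some rigid motion `g`, the configuration within
`3a₀ = 2931/1000` of `y i` is `a₀/2`-separated and TWO-WAY `a₀/8`-MATCHED to the affinely strained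
ideal stacking `g (F (barlowStacking 1 √(2/3) s))`.  So EVERY homogeneous elastic state of the
Barlow family with principal stretches within `±10 %` (all shears included) and every non-affine
wiggle up to `a₀/8 ≈ 0.12` per atom is near₂; what is far₂ is topological or gross: vacancies,
interstitials, dislocation cores, grain boundaries, free surfaces, icosahedral / Frank–Kasper /
bcc order, jitterbug-twisted shells, crowding.

* `stub_defectFarSiteGap` (FAR₂) — every site that is NOT near₂ costs `κ₂ > 0` above `N e_χ*`.
  THE OPEN CORE: finite-range energetic crystallization for `V_χ` with linear DEFECT pricing.  It is
  implied (modulo the radius/separation conventions `3a₀`, `a₀/2` for `3a`, `a/2`) by s2's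
  `BarlowFarSiteGap`, because an s2-reference `barlowStacking a c s` is `F (barlowStacking 1 √(2/3) s)`
  with `F = diag(a, a, c/√(2/3))`, which is within `10 %` of `a₀ • id` on s2's window, and
  `a/50 < a₀/8`; hence it is the WEAKEST far-type statement on the board, and the best conditioned:
  its constant is no longer set by elastic contagion (s2: one atom displaced by `2a/50` makes `≈ 160`
  sites far at harmonic cost `≈ 1.8e-2`, `κ ≲ 1e-4`) but by POINT DEFECTS (kit j026758 of this
  session, hcp* 336-atom cell: relaxed vacancy `0.602` for `≤ 140` far₂ sites ⇒ `κ₂ ≤ 4.3e-3`, the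
  binding ceiling; octahedral self-interstitial `2.69/257 ⇒ 1.0e-2`; one atom displaced by `> 2a₀/8`
  costs `≥ 2.48` unrelaxed for `≈ 139` patch sites ⇒ `1.8e-2`).
* `stub_chargedNearSiteDeviates` (THRESH) — PURE GEOMETRY, the threshold lever made a lemma: a near₂
  site that is CHARGED at tolerance `1/100` either has, within `5a₀/2`, a reference point whose
  twelve strained bond lengths `‖F e‖` (`e` the unit bond vectors of the ideal stacking at that
  point) are split by more than the ratio `2007/2000`, or has, within `5a₀/2`, an atom deviating by
  `≥ a₀/5000` from every reference point.  Contrapositive = charge-freeness of configurations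
  `a₀/5000`-close to a window-conformal strained stacking (margin ledger in the line card §THRESH;
  the abstract engine is the landed `isChargeFree_of_wideGermMatched`, p125113, here for STRAINED
  references: the two up-vector kinds `±w + h e₃` of a Hägg stacking force the window ratio to enter
  squared, `1.0035² + 4.02·δ/m < 1.01`).
* `stub_nonlinearRigidityEngine` (ENGINE₂) — `THRESH → NEAR₂`, NEAR₂ = "charged near₂ sites cost
  `κ₁ > 0` above `N e_χ*` up to an allowance `C` per far₂ site".  Closed technology, XL: (i) sitewise
  reference energies are `≥ e_χ*` because the range-2 site energy of a strained Barlow stacking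
  depends only on the kinds of the two adjacent layers, so it takes three values, each the energy per
  particle of a PERIODIC configuration (`F`·fcc, `F`·dhcp, `F`·hcp), each `≥ e_χ*` by `ciInf_le`
  (`BddBelow` = landed p84999); (ii) first-order terms telescope to a flux through near₂/far₂
  interfaces, `≤ C` per far₂ site by finite range, `V_χ ≥ −1/12` and Ruelle superstability (p124427 —
  where `Function.Injective` is used); (iii) second order and beyond: a CERTIFIED NONLINEAR
  Cauchy–Born + layer-shift (γ-surface) landscape of the Barlow family on the `10 %`/`a₀/8` basin
  (finite-dimensional: strain `F`, the two layer-offset kinds, and the `a₀/8` cell wiggles; no other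
  energy well inside the basin: bcc needs the Bain stretch `(−20 %, +12 %, +12 %)`, a stacking change
  needs a layer slide of `a/√3 ≈ 0.577a` through the unstable-fault saddle at `≈ 0.29a > 2·a₀/8`;
  CHEAPEST FALSIFIER RUN, kit j026758 A4/A5: unrelaxed Cauchy–Born excess of hcp* under uniaxial,
  isotropic and shear strains `±0.5 … ±10 %` is positive and monotone in `|ε|` throughout (shear
  `3.1e-5 → 1.2e-2`, uniaxial `1.3e-4 → 3.5e-2 / 8.5e-2`, isotropic `5.6e-4 → 0.12 / 0.51`), and the
  layer-slide energy rises monotonically `6.9e-4 (0.02a) → 1.9e-2 (a/8) → 4.2e-2` at the saddle `0.29a`),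
  plus discrete nonlinear geometric rigidity with defect allowance (FrieseckeJamesMuller2002 Thm 3.1,
  Schmidt2009, Theil2011, ContiDolzmannKirchheimMüller 2006, EMing2006, HudsonOrtner2011,
  FrieseckeTheil2002, FlatleyTheil2015 Props. 3.12–3.14); (iv) the lever: by THRESH a charged near₂
  site has a window-bad reference (landscape: `≥ c·(deviatoric strain)² ≥ c·(1e-3)²`) or a
  non-affine deviation `≥ a₀/5000` within `5a₀/2` (rigidity: `≥ c'(a₀/5000)²` shared by boundedly
  many sites) — `κ₁` is tiny (`~1e-8`) but the crux asks only for existence.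
  Versus s2's N3 at `a/50`: there the harmonic remainder must already cover bond strains of `4 %`
  (`LJ` cubic/quadratic ratio `≈ 21·Δr = 84 %`), i.e. N3 is not perturbative either; ENGINE₂ says so
  openly and moves the WHOLE elastic basin to the closed-technology side, leaving FAR₂ defect-only.

COMPOSITION (`TruncatedCensusGap_of`, sorry-free): a charged site is charged-and-near₂ or far₂, so
`#charged ≤ #(charged ∧ near₂) + #far₂`; with `κ₂ #far₂ ≤ E − N e*` (FAR₂) and
`κ₁ #(charged ∧ near₂) ≤ E − N e* + C #far₂` (NEAR₂ = ENGINE₂ THRESH) the crux holds with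
`κ := κ₁κ₂/(κ₁ + κ₂ + max C 0)` — the glue `truncatedCensusGap_of_elasticBasinSplit` of §4
(algebra identical to s2's `truncatedCensusGap_of_nearFarSplit`).

DISPROOF USED (`Cruxes/TruncatedCensusGap/Disproof.lean`, cdisprove g2, re-read 2026-08-17T15Z; the
landed Negative lemmas are imported above): `truncatedCensusGap_false_without_injective` honoured —
FAR₂ and NEAR₂ keep `Function.Injective y`, and ENGINE₂ step (ii) USES it (superstability refund of
crowded far₂ clusters; inside near₂ patches `a₀/2`-separation identifies sites with points);
`truncatedCensusGap_kappa_zero_iff_bddBelow` / `KappaZeroHalf` honoured — `e_χ*` enters FAR₂/NEAR₂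
only UPWARD (`ciInf_le` under `BddBelow`), never as a number; §6 `not_isChargeFree_of_short_bond` +
numerics (`κ ≤ 2.7e-5`, compressed pair; lead c4: `κ_R ≤ 1.2e-4`, stretched bond): all are NEAR₂
events (displacements `≪ a₀/8`), consistent with `κ₁` existential and tiny; §7 near-miss (periodic
pricing) transfers verbatim to FAR₂ for its attacker.  `-- Targets`: none filed.  No stub is an
instance of a landed Negative lemma (FAR₂/NEAR₂ carry the genuine infimum and injectivity; THRESH is
potential-free geometry).

RESHAPE r1 (lead c6, prover-line-stmt-AtomisticToContinuum-14230-c6-0, 2026-08-17).  PICKED this line.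
THRESH is DERIVED (`chargedNearSiteDeviates_of`, proved in §4: pull back by the rigid motion, take
`T := g ∘ F '' barlowStacking 1 √(2/3) s`) from two registered worker-sized stubs —
`stub_strainedLinkDictionary` (T1: the link dictionary of an affinely strained ideal stacking:
`0.8793`-separation, near `⟺ dist = 1 ⟹ ≤ 1.0747` under `‖F - a₀‖ ≤ a₀/10`, twelve near points, four
common near points — from the landed `stub_barlowWindowLink` at `(a, c) = (1, √(2/3))`) and
`stub_ratioGermEngine` (T2: the abstract charge-freeness engine in RATIO form — per-centre bond-length
ratio `≤ 2007/2000` within `5a₀/2`, `a₀/5000`-matching — the strained twin of the landed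
`isChargeFree_of_wideGermMatched`, p125113; margin `1.0035² + 4.03 δ/m = 1.0079 < 1.01`).  ENGINE₂ is
SPLIT at its chart-free waist: `stub_localPricingEngine : ChargedNearSiteDeviates → LocalNearPricing₂`
(the XL / open content: zero-sum bounded transfers pricing every deep-near₂ site at `e_χ*`, charged ones at
`e_χ* + κ`; held by the lead) and the bookkeeping `LocalNearPricing₂ → NearChargePricing′ → NearChargePricing`
PROVED here (`nearChargePricing'_of_localNearPricing₂` by the landed `near_pricing_assembly`, p169781, whose
only use of the near predicate is the separation clause `a = 977/1000`; `nearChargePricing_of_prime`).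
Registered stubs after r1: FAR₂ `stub_defectFarSiteGap` (open core), T1, T2, `stub_localPricingEngine` (4 ≤ 7).
STATUS (lead c6, wave 1, all ACCEPTED): T1 LANDED p173403, T2 LANDED p173397 — THRESH is a THEOREM
(`chargedNearSiteDeviates_holds` below; Theorems file `…ChargedNearSiteDeviates.lean`); split-ready glue LANDED
p173395 (`…ElasticBasinSplit.lean`: crux ⇐ FAR₂ ∧ NEAR₂, crux ⇐ FAR₂ ∧ LNP₂, NEAR₂ ⇐ crux, THRESH ⇐ T1 ∧ T2);
FAR₂ periodic form + kill criterion LANDED p173835 (`defectFarSiteGap_iff_periodicDefectFarPricing`,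
`lt_energyPerParticle_of_motifDefectFar`; helpers p173409 locality, p173728 blocks).  Skeleton sorries = 2 =
the two OPEN CORES `stub_defectFarSiteGap` (FAR₂) and `stub_localPricingEngine` (THRESH → LNP₂).
-/


noncomputable section

namespace Summit.AtomisticToContinuum.Crystallization.Cruxes.TruncatedCensusGap.ElasticBasinSplit

open scoped BigOperators Classical
open Literature.MathematicalPhysics.StatisticalMechanics Literature.Geometry.DiscreteGeometry
open Summit.AtomisticToContinuum.Crystallization.Theses.PricedLinkCensus (TruncatedCensusGap)
open Summit.AtomisticToContinuum.Crystallization.Theorems.PricedLinkCensusTruncatedCensusGap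
  (near_pricing_assembly iInf_energyPerParticle_truncLJ_nonpos)

/-! ## §1 The statements (named Props; the registered stubs of §2 restate them verbatim) -/

/-- **(FAR₂) defect far-site gap** — sites whose closed `3a₀`-patch is not two-way `a₀/8`-matched to
an affinely strained (`10 %`) Barlow stacking pay `κ₂`. -/
def DefectFarSiteGap : Prop :=
  ∃ κ : ℝ, 0 < κ ∧ ∀ (N : ℕ) (y : Fin N → EuclideanSpace ℝ (Fin 3)), Function.Injective y → (N : ℝ) * (⨅ Q : Literature.MathematicalPhysics.StatisticalMechanics.PeriodicConfiguration 3, Q.energyPerParticle (fun r => min 1 (max 0 (4 - 2 * r)) * Literature.MathematicalPhysics.StatisticalMechanics.lennardJones r)) + κ * (Nat.card {i : Fin N // ¬ ∃ (s : ℤ → ℤ) (F : EuclideanSpace ℝ (Fin 3) →L[ℝ] EuclideanSpace ℝ (Fin 3)) (g : EuclideanSpace ℝ (Fin 3) ≃ᵃⁱ[ℝ] EuclideanSpace ℝ (Fin 3)), Literature.MathematicalPhysics.StatisticalMechanics.IsHaggSeq s ∧ (∀ v : EuclideanSpace ℝ (Fin 3), ‖F v - (977 / 1000 : ℝ) • v‖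 ≤ 977 / 10000 * ‖v‖) ∧ (∀ j k : Fin N, j ≠ k → dist (y j) (y i) ≤ 2931 / 1000 → 977 / 2000 ≤ dist (y j) (y k)) ∧ (∀ j : Fin N, dist (y j) (y i) ≤ 2931 / 1000 → ∃ z ∈ Literature.MathematicalPhysics.StatisticalMechanics.barlowStacking 1 (Real.sqrt (2 / 3)) s, dist (y j) (g (F z)) ≤ 977 / 8000) ∧ (∀ z ∈ Literature.MathematicalPhysics.StatisticalMechanics.barlowStacking 1 (Real.sqrt (2 / 3)) s, dist (g (F z)) (y i) ≤ 2931 / 1000 → ∃ j : Fin N, dist (y j) (g (F z)) ≤ 977 / 8000)} : ℝ) ≤ Literature.MathematicalPhysics.StatisticalMechanics.interactionEnergy (fun r => min 1 (max 0 (4 - 2 * r)) * Literature.MathematicalPhysics.StatisticalMechanics.lennardJones r) y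

/-- **(NEAR₂) charged near₂-site pricing with far₂ allowance** — charged sites whose `3a₀`-patch IS in
the elastic basin pay `κ₁`, up to `C` per far₂ site. -/
def NearChargePricing : Prop :=
  ∃ κ C : ℝ, 0 < κ ∧ ∀ (N : ℕ) (y : Fin N → EuclideanSpace ℝ (Fin 3)), Function.Injective y → (N : ℝ) * (⨅ Q : Literature.MathematicalPhysics.StatisticalMechanics.PeriodicConfiguration 3, Q.energyPerParticle (fun r => min 1 (max 0 (4 - 2 * r)) * Literature.MathematicalPhysics.StatisticalMechanics.lennardJones r)) + κ * (Nat.card {i : Fin N // ¬ Literature.Geometry.DiscreteGeometry.IsChargeFree (1 / 100 : ℝ) y i ∧ ∃ (s : ℤ → ℤ) (F : EuclideanSpace ℝ (Fin 3) →L[ℝ] EuclideanSpace ℝ (Fin 3)) (g : EuclideanSpace ℝ (Fin 3) ≃ᵃⁱ[ℝ] EuclideanSpace ℝ (Fin 3)), Literature.MathematicalPhysics.StatisticalMechanics.IsHaggSeq s ∧ (∀ v : EuclideanSpace ℝ (Fin 3), ‖F v - (977 / 1000 : ℝ) • v‖ ≤ 977 / 10000 * ‖v‖) ∧ (∀ j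 k : Fin N, j ≠ k → dist (y j) (y i) ≤ 2931 / 1000 → 977 / 2000 ≤ dist (y j) (y k)) ∧ (∀ j : Fin N, dist (y j) (y i) ≤ 2931 / 1000 → ∃ z ∈ Literature.MathematicalPhysics.StatisticalMechanics.barlowStacking 1 (Real.sqrt (2 / 3)) s, dist (y j) (g (F z)) ≤ 977 / 8000) ∧ (∀ z ∈ Literature.MathematicalPhysics.StatisticalMechanics.barlowStacking 1 (Real.sqrt (2 / 3)) s, dist (g (F z)) (y i) ≤ 2931 / 1000 → ∃ j : Fin N, dist (y j) (g (F z)) ≤ 977 / 8000)} : ℝ) ≤ Literature.MathematicalPhysics.StatisticalMechanics.interactionEnergy (fun r => min 1 (max 0 (4 - 2 * r)) * Literature.MathematicalPhysics.StatisticalMechanics.lennardJones r) y + C * (Nat.card {i : Fin N // ¬ ∃ (s : ℤ → ℤ) (F : EuclideanSpace ℝ (Fin 3) →L[ℝ] EuclideanSpace ℝ (Fin 3)) (g : EuclideanSpace ℝ (Fin 3) ≃ᵃⁱ[ℝ] EuclideanSpace ℝ (Fin 3)), Literature.MathematicalPhysics.StatisticalMechanics.IsHaggSeq s ∧ (∀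 v : EuclideanSpace ℝ (Fin 3), ‖F v - (977 / 1000 : ℝ) • v‖ ≤ 977 / 10000 * ‖v‖) ∧ (∀ j k : Fin N, j ≠ k → dist (y j) (y i) ≤ 2931 / 1000 → 977 / 2000 ≤ dist (y j) (y k)) ∧ (∀ j : Fin N, dist (y j) (y i) ≤ 2931 / 1000 → ∃ z ∈ Literature.MathematicalPhysics.StatisticalMechanics.barlowStacking 1 (Real.sqrt (2 / 3)) s, dist (y j) (g (F z)) ≤ 977 / 8000) ∧ (∀ z ∈ Literature.MathematicalPhysics.StatisticalMechanics.barlowStacking 1 (Real.sqrt (2 / 3)) s, dist (g (F z)) (y i) ≤ 2931 / 1000 → ∃ j : Fin N, dist (y j) (g (F z)) ≤ 977 / 8000)} : ℝ)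

/-- **(THRESH) a charged near₂ site deviates** — window-bad reference within `5a₀/2`, or an atom within
`5a₀/2` at distance `≥ a₀/5000` from every reference point. -/
def ChargedNearSiteDeviates : Prop :=
  ∀ (N : ℕ) (y : Fin N → EuclideanSpace ℝ (Fin 3)), Function.Injective y → ∀ (i : Fin N) (s : ℤ → ℤ) (F : EuclideanSpace ℝ (Fin 3) →L[ℝ] EuclideanSpace ℝ (Fin 3)) (g : EuclideanSpace ℝ (Fin 3) ≃ᵃⁱ[ℝ] EuclideanSpace ℝ (Fin 3)), Literature.MathematicalPhysics.StatisticalMechanics.IsHaggSeq s → (∀ v : EuclideanSpace ℝ (Fin 3), ‖F v - (977 / 1000 : ℝ) • v‖ ≤ 977 / 10000 * ‖v‖) → (∀ j k : Fin N, j ≠ k → dist (y j) (y i) ≤ 2931 / 1000 → 977 / 2000 ≤ dist (y j) (y k)) → (∀ j : Fin N, dist (y j) (y i) ≤ 2931 / 1000 → ∃ z ∈ Literature.MathematicalPhysics.StatisticalMechanics.barlowStacking 1 (Real.sqrt (2 / 3)) s, dist (y j) (g (F z)) ≤ 977 / 8000) → (∀ z ∈ Literature.MathematicalPhysics.StatisticalMechanics.barlowStacking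 1 (Real.sqrt (2 / 3)) s, dist (g (F z)) (y i) ≤ 2931 / 1000 → ∃ j : Fin N, dist (y j) (g (F z)) ≤ 977 / 8000) → ¬ Literature.Geometry.DiscreteGeometry.IsChargeFree (1 / 100 : ℝ) y i → (∃ z₀ ∈ Literature.MathematicalPhysics.StatisticalMechanics.barlowStacking 1 (Real.sqrt (2 / 3)) s, ∃ z ∈ Literature.MathematicalPhysics.StatisticalMechanics.barlowStacking 1 (Real.sqrt (2 / 3)) s, ∃ z' ∈ Literature.MathematicalPhysics.StatisticalMechanics.barlowStacking 1 (Real.sqrt (2 / 3)) s, dist (g (F z₀)) (y i) ≤ 4885 / 2000 ∧ dist z z₀ = 1 ∧ dist z' z₀ = 1 ∧ (2007 / 2000 : ℝ) * ‖F (z' - z₀)‖ < ‖F (z - z₀)‖) ∨ (∃ j : Fin N, dist (y j) (y i) ≤ 4885 / 2000 ∧ ∀ z ∈ Literature.MathematicalPhysics.StatisticalMechanics.barlowStacking 1 (Real.sqrt (2 / 3)) s, (977 / 5000000 : ℝ) ≤ dist (y j) (g (F z)))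

/-- **(T1) strained link dictionary** (reshape r1) — for a Hägg word `s` and a linear `F` within `10 %`
of `a₀ • id`, the strained ideal stacking `F '' barlowStacking 1 √(2/3) s` is `0.8793`-separated, its
near points (`‖F (z - z₀)‖ < 1.231`) are exactly the twelve ideal nearest neighbours (`dist z z₀ = 1`,
strained length `≤ 1.0747`), and two near points have exactly four common near points. -/
def StrainedLinkDictionary : Prop :=
  ∀ (s : ℤ → ℤ) (F : EuclideanSpace ℝ (Fin 3) →L[ℝ] EuclideanSpace ℝ (Fin 3)), Literature.MathematicalPhysics.StatisticalMechanics.IsHaggSeq s → (∀ v : EuclideanSpace ℝ (Fin 3), ‖F v - (977 / 1000 : ℝ) • v‖ ≤ 977 / 10000 * ‖v‖) → ∀ z₀ ∈ Literature.MathematicalPhysics.StatisticalMechanics.barlowStacking 1 (Real.sqrt (2 / 3)) s, (∀ z ∈ Literature.MathematicalPhysics.StatisticalMechanics.barlowStacking 1 (Real.sqrt (2 / 3)) s, z ≠ z₀ → (8793 / 10000 : ℝ) ≤ ‖F (z - z₀)‖) ∧ (∀ z ∈ Literature.MathematicalPhysics.StatisticalMechanics.barlowStacking 1 (Real.sqrt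 (2 / 3)) s, z ≠ z₀ → ‖F (z - z₀)‖ < 1231 / 1000 → dist z z₀ = 1 ∧ ‖F (z - z₀)‖ ≤ 10747 / 10000) ∧ {z ∈ Literature.MathematicalPhysics.StatisticalMechanics.barlowStacking 1 (Real.sqrt (2 / 3)) s | z ≠ z₀ ∧ ‖F (z - z₀)‖ < 1231 / 1000}.ncard = 12 ∧ (∀ z ∈ Literature.MathematicalPhysics.StatisticalMechanics.barlowStacking 1 (Real.sqrt (2 / 3)) s, z ≠ z₀ → ‖F (z - z₀)‖ < 1231 / 1000 → {w ∈ Literature.MathematicalPhysics.StatisticalMechanics.barlowStacking 1 (Real.sqrt (2 / 3)) s | w ≠ z₀ ∧ w ≠ z ∧ ‖F (w - z₀)‖ < 1231 / 1000 ∧ ‖F (w - z)‖ < 1231 / 1000}.ncard = 4)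

/-- **(T2) ratio germ engine** (reshape r1) — the abstract charge-freeness engine in ratio form: a site
whose `3a₀`-patch is `a₀/2`-separated, whose `5a₀/2`-patch is `a₀/5000`-matched INTO a `0.8793`-separated
point set `T` with cuboctahedral/anticuboctahedral near-structure (twelve near points `< 1.231`, each
`≤ 1.0747`, four common near points) whose near lengths at every centre within `5a₀/2` are split by at
most the ratio `2007/2000`, and ONTO which every `T`-point within `3a₀` is `a₀/8`-matched, is charge-free
at tolerance `1/100`. -/
def RatioGermEngine : Prop :=
  ∀ (N : ℕ) (y : Fin N → EuclideanSpace ℝ (Fin 3)) (i : Fin N) (T : Set (EuclideanSpace ℝ (Fin 3))), (∀ z ∈ T, ∀ w ∈ T, z ≠ w → (8793 / 10000 : ℝ) ≤ dist z w) → (∀ z₀ ∈ T, ∀ z ∈ T, z ≠ z₀ → dist z z₀ < 1231 / 1000 → dist z z₀ ≤ 10747 / 10000) → (∀ z₀ ∈ T, {z ∈ T | z ≠ z₀ ∧ dist z z₀ < 1231 / 1000}.ncard = 12) → (∀ z₀ ∈ T, ∀ z ∈ T, z ≠ z₀ → dist z z₀ < 1231 / 1000 → {w ∈ T | w ≠ z₀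 ∧ w ≠ z ∧ dist w z₀ < 1231 / 1000 ∧ dist w z < 1231 / 1000}.ncard = 4) → (∀ z₀ ∈ T, dist z₀ (y i) ≤ 4885 / 2000 → ∀ z ∈ T, ∀ z' ∈ T, z ≠ z₀ → z' ≠ z₀ → dist z z₀ < 1231 / 1000 → dist z' z₀ < 1231 / 1000 → dist z z₀ ≤ 2007 / 2000 * dist z' z₀) → (∀ j k : Fin N, j ≠ k → dist (y j) (y i) ≤ 2931 / 1000 → 977 / 2000 ≤ dist (y j) (y k)) → (∀ z ∈ T, dist z (y i) ≤ 2931 / 1000 → ∃ j : Fin N, dist (y j) z ≤ 977 / 8000) → (∀ j : Fin N, dist (y j) (y i) ≤ 4885 / 2000 → ∃ z ∈ T, dist (y j) z < 977 / 5000000) → Literature.Geometry.DiscreteGeometry.IsChargeFree (1 / 100 : ℝ) y i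

/-- **(LNP₂) local near₂ pricing** (reshape r1; the chart-free waist of ENGINE₂) — zero-sum transfers
`Φ`, `|Φ| ≤ C`, such that every DEEP-near₂ site (all sites within `ρ` are near₂) has redistributed
half-site-energy `≥ e_χ*`, and `≥ e_χ* + κ` if it is charged.  XL / open (the elastic-basin twin of
`near_far_split`'s N2′). -/
def LocalNearPricing₂ : Prop :=
  ∃ κ C ρ : ℝ, 0 < κ ∧ ∃ Φ : (N : ℕ) → (Fin N → EuclideanSpace ℝ (Fin 3)) → Fin N → ℝ, (∀ (N : ℕ) (y : Fin N → EuclideanSpace ℝ (Fin 3)), Function.Injective y → ∑ i, Φ N y i = 0) ∧ (∀ (N : ℕ) (y : Fin N → EuclideanSpace ℝ (Fin 3)) (i : Fin N), Function.Injective y → |Φ N y i| ≤ C) ∧ ∀ (N : ℕ) (y : Fin N → EuclideanSpace ℝ (Fin 3)) (i : Fin N), Function.Injective y → (∀ i' : Fin N, dist (y i') (y i) ≤ ρ → ∃ (s : ℤ → ℤ) (F : EuclideanSpace ℝ (Fin 3) →L[ℝ] EuclideanSpace ℝ (Fin 3)) (g : EuclideanSpace ℝ (Fin 3) ≃ᵃⁱ[ℝ]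 EuclideanSpace ℝ (Fin 3)), Literature.MathematicalPhysics.StatisticalMechanics.IsHaggSeq s ∧ (∀ v : EuclideanSpace ℝ (Fin 3), ‖F v - (977 / 1000 : ℝ) • v‖ ≤ 977 / 10000 * ‖v‖) ∧ (∀ j k : Fin N, j ≠ k → dist (y j) (y i') ≤ 2931 / 1000 → 977 / 2000 ≤ dist (y j) (y k)) ∧ (∀ j : Fin N, dist (y j) (y i') ≤ 2931 / 1000 → ∃ z ∈ Literature.MathematicalPhysics.StatisticalMechanics.barlowStacking 1 (Real.sqrt (2 / 3)) s, dist (y j) (g (F z)) ≤ 977 / 8000) ∧ (∀ z ∈ Literature.MathematicalPhysics.StatisticalMechanics.barlowStacking 1 (Real.sqrt (2 / 3)) s, dist (g (F z)) (y i') ≤ 2931 / 1000 → ∃ j : Fin N, dist (y j) (g (F z)) ≤ 977 / 8000)) → (⨅ Q : Literature.MathematicalPhysics.StatisticalMechanics.PeriodicConfiguration 3, Q.energyPerParticle (fun r => min 1 (max 0 (4 - 2 * r)) * Literature.MathematicalPhysics.StatisticalMechanics.lennardJones r)) ≤ Literature.MathematicalPhysics.StatisticalMechanics.siteEnergy (fun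 r => min 1 (max 0 (4 - 2 * r)) * Literature.MathematicalPhysics.StatisticalMechanics.lennardJones r) y i / 2 + Φ N y i ∧ (¬ Literature.Geometry.DiscreteGeometry.IsChargeFree (1 / 100 : ℝ) y i → (⨅ Q : Literature.MathematicalPhysics.StatisticalMechanics.PeriodicConfiguration 3, Q.energyPerParticle (fun r => min 1 (max 0 (4 - 2 * r)) * Literature.MathematicalPhysics.StatisticalMechanics.lennardJones r)) + κ ≤ Literature.MathematicalPhysics.StatisticalMechanics.siteEnergy (fun r => min 1 (max 0 (4 - 2 * r)) * Literature.MathematicalPhysics.StatisticalMechanics.lennardJones r) y i / 2 + Φ N y i)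

/-- **(NEAR₂′)** `NearChargePricing` with the near₂ set passed as a `Finset` (one occurrence of the
predicate; registrable length); `nearChargePricing_of_prime` recovers NEAR₂. -/
def NearChargePricing' : Prop :=
  ∃ κ C : ℝ, 0 < κ ∧ ∀ (N : ℕ) (y : Fin N → EuclideanSpace ℝ (Fin 3)), Function.Injective y → ∀ S : Finset (Fin N), (∀ i : Fin N, i ∈ S ↔ ∃ (s : ℤ → ℤ) (F : EuclideanSpace ℝ (Fin 3) →L[ℝ] EuclideanSpace ℝ (Fin 3)) (g : EuclideanSpace ℝ (Fin 3) ≃ᵃⁱ[ℝ] EuclideanSpace ℝ (Fin 3)), Literature.MathematicalPhysics.StatisticalMechanics.IsHaggSeq s ∧ (∀ v : EuclideanSpace ℝ (Fin 3), ‖F v - (977 / 1000 : ℝ) • v‖ ≤ 977 / 10000 * ‖v‖) ∧ (∀ j k : Fin N, j ≠ k → dist (y j) (y i) ≤ 2931 / 1000 → 977 / 2000 ≤ dist (y j) (y k)) ∧ (∀ j : Fin N, dist (y j) (y i) ≤ 2931 / 1000 → ∃ z ∈ Literature.MathematicalPhysics.StatisticalMechanics.barlowStacking 1 (Real.sqrt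 (2 / 3)) s, dist (y j) (g (F z)) ≤ 977 / 8000) ∧ (∀ z ∈ Literature.MathematicalPhysics.StatisticalMechanics.barlowStacking 1 (Real.sqrt (2 / 3)) s, dist (g (F z)) (y i) ≤ 2931 / 1000 → ∃ j : Fin N, dist (y j) (g (F z)) ≤ 977 / 8000)) → (N : ℝ) * (⨅ Q : Literature.MathematicalPhysics.StatisticalMechanics.PeriodicConfiguration 3, Q.energyPerParticle (fun r => min 1 (max 0 (4 - 2 * r)) * Literature.MathematicalPhysics.StatisticalMechanics.lennardJones r)) + κ * (Nat.card {i : Fin N // ¬ Literature.Geometry.DiscreteGeometry.IsChargeFree (1 / 100 : ℝ) y i ∧ i ∈ S} : ℝ) ≤ Literature.MathematicalPhysics.StatisticalMechanics.interactionEnergy (fun r => min 1 (max 0 (4 - 2 * r)) * Literature.MathematicalPhysics.StatisticalMechanics.lennardJones r) y + C * ((Finset.univ \ S).card : ℝ)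

/-! ## §2 The registered stubs (`sorry` lives only in `stub_defectFarSiteGap` and `stub_localPricingEngine`; T1, T2 LANDED) -/

/-- **STUB (FAR₂)** `stub_defectFarSiteGap` — THE OPEN CORE (finite-range crystallization for `V_χ`
with linear pricing of topological/gross defects; XL / open-problem; expected `κ₂ ≲ 4e-3`). -/
theorem stub_defectFarSiteGap :
    ∃ κ : ℝ, 0 < κ ∧ ∀ (N : ℕ) (y : Fin N → EuclideanSpace ℝ (Fin 3)), Function.Injective y → (N : ℝ) * (⨅ Q : Literature.MathematicalPhysics.StatisticalMechanics.PeriodicConfiguration 3, Q.energyPerParticle (fun r => min 1 (max 0 (4 - 2 * r)) * Literature.MathematicalPhysics.StatisticalMechanics.lennardJones r)) + κ * (Nat.card {i : Fin N // ¬ ∃ (s : ℤ → ℤ) (F : EuclideanSpace ℝ (Fin 3) →L[ℝ] EuclideanSpace ℝ (Fin 3)) (g : EuclideanSpace ℝ (Fin 3) ≃ᵃⁱ[ℝ] EuclideanSpace ℝ (Fin 3)), Literature.MathematicalPhysics.StatisticalMechanics.IsHaggSeq s ∧ (∀ v : EuclideanSpace ℝ (Fin 3), ‖F v - (977 / 1000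 : ℝ) • v‖ ≤ 977 / 10000 * ‖v‖) ∧ (∀ j k : Fin N, j ≠ k → dist (y j) (y i) ≤ 2931 / 1000 → 977 / 2000 ≤ dist (y j) (y k)) ∧ (∀ j : Fin N, dist (y j) (y i) ≤ 2931 / 1000 → ∃ z ∈ Literature.MathematicalPhysics.StatisticalMechanics.barlowStacking 1 (Real.sqrt (2 / 3)) s, dist (y j) (g (F z)) ≤ 977 / 8000) ∧ (∀ z ∈ Literature.MathematicalPhysics.StatisticalMechanics.barlowStacking 1 (Real.sqrt (2 / 3)) s, dist (g (F z)) (y i) ≤ 2931 / 1000 → ∃ j : Fin N, dist (y j) (g (F z)) ≤ 977 / 8000)} : ℝ) ≤ Literature.MathematicalPhysics.StatisticalMechanics.interactionEnergy (fun r => min 1 (max 0 (4 - 2 * r)) * Literature.MathematicalPhysics.StatisticalMechanics.lennardJones r) y := by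
  sorry

example : DefectFarSiteGap := stub_defectFarSiteGap

/-- **T1 `stub_strainedLinkDictionary` — LANDED** (p173403, stub-worker of lead c6, wave 1;
`Theorems/PricedLinkCensusTruncatedCensusGapStrainedLinkDictionary.lean`, 176 lines: norm sandwich
`0.8793‖v‖ ≤ ‖F v‖ ≤ 1.0747‖v‖` + the window link at `(1, √(2/3))`). -/
theorem stub_strainedLinkDictionary :
    ∀ (s : ℤ → ℤ) (F : EuclideanSpace ℝ (Fin 3) →L[ℝ] EuclideanSpace ℝ (Fin 3)), Literature.MathematicalPhysics.StatisticalMechanics.IsHaggSeq s → (∀ v : EuclideanSpace ℝ (Fin 3), ‖F v - (977 / 1000 : ℝ) • v‖ ≤ 977 / 10000 * ‖v‖) → ∀ z₀ ∈ Literature.MathematicalPhysics.StatisticalMechanics.barlowStacking 1 (Real.sqrt (2 / 3)) s, (∀ z ∈ Literature.MathematicalPhysics.StatisticalMechanics.barlowStacking 1 (Real.sqrt (2 / 3)) s, z ≠ z₀ → (8793 / 10000 : ℝ) ≤ ‖F (z - z₀)‖) ∧ (∀ z ∈ Literature.MathematicalPhysics.StatisticalMechanics.barlowStacking 1 (Real.sqrt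 (2 / 3)) s, z ≠ z₀ → ‖F (z - z₀)‖ < 1231 / 1000 → dist z z₀ = 1 ∧ ‖F (z - z₀)‖ ≤ 10747 / 10000) ∧ {z ∈ Literature.MathematicalPhysics.StatisticalMechanics.barlowStacking 1 (Real.sqrt (2 / 3)) s | z ≠ z₀ ∧ ‖F (z - z₀)‖ < 1231 / 1000}.ncard = 12 ∧ (∀ z ∈ Literature.MathematicalPhysics.StatisticalMechanics.barlowStacking 1 (Real.sqrt (2 / 3)) s, z ≠ z₀ → ‖F (z - z₀)‖ < 1231 / 1000 → {w ∈ Literature.MathematicalPhysics.StatisticalMechanics.barlowStacking 1 (Real.sqrt (2 / 3)) s | w ≠ z₀ ∧ w ≠ z ∧ ‖F (w - z₀)‖ < 1231 / 1000 ∧ ‖F (w - z)‖ < 1231 / 1000}.ncard = 4) :=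
  Theorems.PricedLinkCensusTruncatedCensusGap.stub_strainedLinkDictionary

example : StrainedLinkDictionary := stub_strainedLinkDictionary

/-- **T2 `stub_ratioGermEngine` — LANDED** (p173397, stub-worker of lead c6, wave 1;
`Theorems/PricedLinkCensusTruncatedCensusGapRatioGermEngine.lean`, 392 lines: ratio-form germ engine,
minimum-free nearest-distance bounds `L − 2δ`, KEY margin `6.477e-3·d − 4.02δ ≥ 4.9e-3`). -/
theorem stub_ratioGermEngine :
    ∀ (N : ℕ) (y : Fin N → EuclideanSpace ℝ (Fin 3)) (i : Fin N) (T : Set (EuclideanSpace ℝ (Fin 3))), (∀ z ∈ T, ∀ w ∈ T, z ≠ w → (8793 / 10000 : ℝ) ≤ dist z w) → (∀ z₀ ∈ T, ∀ z ∈ T, z ≠ z₀ → dist z z₀ < 1231 / 1000 → dist z z₀ ≤ 10747 / 10000) → (∀ z₀ ∈ T, {z ∈ T | z ≠ z₀ ∧ dist z z₀ < 1231 / 1000}.ncard = 12) → (∀ z₀ ∈ T, ∀ z ∈ T, z ≠ z₀ → dist z z₀ < 1231 / 1000 → {w ∈ T | w ≠ z₀ ∧ w ≠ z ∧ dist w z₀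 < 1231 / 1000 ∧ dist w z < 1231 / 1000}.ncard = 4) → (∀ z₀ ∈ T, dist z₀ (y i) ≤ 4885 / 2000 → ∀ z ∈ T, ∀ z' ∈ T, z ≠ z₀ → z' ≠ z₀ → dist z z₀ < 1231 / 1000 → dist z' z₀ < 1231 / 1000 → dist z z₀ ≤ 2007 / 2000 * dist z' z₀) → (∀ j k : Fin N, j ≠ k → dist (y j) (y i) ≤ 2931 / 1000 → 977 / 2000 ≤ dist (y j) (y k)) → (∀ z ∈ T, dist z (y i) ≤ 2931 / 1000 → ∃ j : Fin N, dist (y j) z ≤ 977 / 8000) → (∀ j : Fin N, dist (y j) (y i) ≤ 4885 / 2000 → ∃ z ∈ T, dist (y j) z < 977 / 5000000) → Literature.Geometry.DiscreteGeometry.IsChargeFree (1 / 100 : ℝ) y i :=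
  Theorems.PricedLinkCensusTruncatedCensusGap.stub_ratioGermEngine

example : RatioGermEngine := stub_ratioGermEngine

/-- **STUB (ENGINE₂′)** `stub_localPricingEngine` — `THRESH → LNP₂`: the certified nonlinear
Cauchy–Born + γ-surface landscape on the `10 %`/`a₀/8` basin and discrete rigidity, delivered as a
chart-free local pricing (XL / open; the lead's stub). -/
theorem stub_localPricingEngine :
    (∀ (N : ℕ) (y : Fin N → EuclideanSpace ℝ (Fin 3)), Function.Injective y → ∀ (i : Fin N) (s : ℤ → ℤ) (F : EuclideanSpace ℝ (Fin 3) →L[ℝ] EuclideanSpace ℝ (Fin 3)) (g : EuclideanSpace ℝ (Fin 3) ≃ᵃⁱ[ℝ] EuclideanSpace ℝ (Fin 3)), Literature.MathematicalPhysics.StatisticalMechanics.IsHaggSeq s → (∀ v : EuclideanSpace ℝ (Fin 3), ‖F v - (977 / 1000 : ℝ) • v‖ ≤ 977 / 10000 * ‖v‖) → (∀ j k : Fin N, j ≠ k → dist (y j) (y i) ≤ 2931 / 1000 → 977 / 2000 ≤ dist (y j) (y k)) → (∀ j : Fin N, dist (y j) (y i) ≤ 2931 / 1000 → ∃ z ∈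 Literature.MathematicalPhysics.StatisticalMechanics.barlowStacking 1 (Real.sqrt (2 / 3)) s, dist (y j) (g (F z)) ≤ 977 / 8000) → (∀ z ∈ Literature.MathematicalPhysics.StatisticalMechanics.barlowStacking 1 (Real.sqrt (2 / 3)) s, dist (g (F z)) (y i) ≤ 2931 / 1000 → ∃ j : Fin N, dist (y j) (g (F z)) ≤ 977 / 8000) → ¬ Literature.Geometry.DiscreteGeometry.IsChargeFree (1 / 100 : ℝ) y i → (∃ z₀ ∈ Literature.MathematicalPhysics.StatisticalMechanics.barlowStacking 1 (Real.sqrt (2 / 3)) s, ∃ z ∈ Literature.MathematicalPhysics.StatisticalMechanics.barlowStacking 1 (Real.sqrt (2 / 3)) s, ∃ z' ∈ Literature.MathematicalPhysics.StatisticalMechanics.barlowStacking 1 (Real.sqrt (2 / 3)) s, dist (g (F z₀)) (y i) ≤ 4885 / 2000 ∧ dist z z₀ = 1 ∧ dist z' z₀ = 1 ∧ (2007 / 2000 : ℝ) * ‖F (z' - z₀)‖ < ‖F (z - z₀)‖) ∨ (∃ j : Fin N, dist (y j) (y i) ≤ 4885 / 2000 ∧ ∀ z ∈ Literature.MathematicalPhysics.StatisticalMechanics.barlowStacking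 1 (Real.sqrt (2 / 3)) s, (977 / 5000000 : ℝ) ≤ dist (y j) (g (F z)))) → (∃ κ C ρ : ℝ, 0 < κ ∧ ∃ Φ : (N : ℕ) → (Fin N → EuclideanSpace ℝ (Fin 3)) → Fin N → ℝ, (∀ (N : ℕ) (y : Fin N → EuclideanSpace ℝ (Fin 3)), Function.Injective y → ∑ i, Φ N y i = 0) ∧ (∀ (N : ℕ) (y : Fin N → EuclideanSpace ℝ (Fin 3)) (i : Fin N), Function.Injective y → |Φ N y i| ≤ C) ∧ ∀ (N : ℕ) (y : Fin N → EuclideanSpace ℝ (Fin 3)) (i : Fin N), Function.Injective y → (∀ i' : Fin N, dist (y i') (y i) ≤ ρ → ∃ (s : ℤ → ℤ) (F : EuclideanSpace ℝ (Fin 3) →L[ℝ] EuclideanSpace ℝ (Fin 3)) (g : EuclideanSpace ℝ (Fin 3) ≃ᵃⁱ[ℝ] EuclideanSpace ℝ (Fin 3)), Literature.MathematicalPhysics.StatisticalMechanics.IsHaggSeq s ∧ (∀ v : EuclideanSpace ℝ (Fin 3), ‖F v - (977 / 1000 : ℝ) • v‖ ≤ 977 / 10000 * ‖v‖) ∧ (∀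 j k : Fin N, j ≠ k → dist (y j) (y i') ≤ 2931 / 1000 → 977 / 2000 ≤ dist (y j) (y k)) ∧ (∀ j : Fin N, dist (y j) (y i') ≤ 2931 / 1000 → ∃ z ∈ Literature.MathematicalPhysics.StatisticalMechanics.barlowStacking 1 (Real.sqrt (2 / 3)) s, dist (y j) (g (F z)) ≤ 977 / 8000) ∧ (∀ z ∈ Literature.MathematicalPhysics.StatisticalMechanics.barlowStacking 1 (Real.sqrt (2 / 3)) s, dist (g (F z)) (y i') ≤ 2931 / 1000 → ∃ j : Fin N, dist (y j) (g (F z)) ≤ 977 / 8000)) → (⨅ Q : Literature.MathematicalPhysics.StatisticalMechanics.PeriodicConfiguration 3, Q.energyPerParticle (fun r => min 1 (max 0 (4 - 2 * r)) * Literature.MathematicalPhysics.StatisticalMechanics.lennardJones r)) ≤ Literature.MathematicalPhysics.StatisticalMechanics.siteEnergy (fun r => min 1 (max 0 (4 - 2 * r)) * Literature.MathematicalPhysics.StatisticalMechanics.lennardJones r) y i / 2 + Φ N y i ∧ (¬ Literature.Geometry.DiscreteGeometry.IsChargeFree (1 / 100 : ℝ) y i → (⨅ Q : Literature.MathematicalPhysics.StatisticalMechanics.PeriodicConfiguration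 3, Q.energyPerParticle (fun r => min 1 (max 0 (4 - 2 * r)) * Literature.MathematicalPhysics.StatisticalMechanics.lennardJones r)) + κ ≤ Literature.MathematicalPhysics.StatisticalMechanics.siteEnergy (fun r => min 1 (max 0 (4 - 2 * r)) * Literature.MathematicalPhysics.StatisticalMechanics.lennardJones r) y i / 2 + Φ N y i)) := by
  sorry

example : ChargedNearSiteDeviates → LocalNearPricing₂ := stub_localPricingEngine

/-! ## §3 Name-keyed aliases (hypotheses of the composition) -/
namespace Registered

/-- Alias keyed by the registered stub name. -/
abbrev stub_defectFarSiteGap : Prop := DefectFarSiteGap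
/-- Alias keyed by the registered stub name. -/
abbrev stub_localPricingEngine : Prop := ChargedNearSiteDeviates → LocalNearPricing₂

end Registered

/-! ## §4 Proved glue (sorry-free) -/

/-- **THRESH from T1 and T2** (reshape r1, proved): negate the conclusion, take
`T := (g ∘ F) '' barlowStacking 1 √(2/3) s` — `dist (g (F z)) (g (F w)) = ‖F (z - w)‖` — and feed the
ratio engine with the dictionary. -/
theorem chargedNearSiteDeviates_of (h1 : StrainedLinkDictionary) (h2 : RatioGermEngine) :
    ChargedNearSiteDeviates := by
  intro N y _hy i s F g hs hF hsep _hM1 hM2 hch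
  by_contra hcon
  have hA : ∀ z₀ ∈ barlowStacking 1 (Real.sqrt (2 / 3)) s, ∀ z ∈ barlowStacking 1 (Real.sqrt (2 / 3)) s,
      ∀ z' ∈ barlowStacking 1 (Real.sqrt (2 / 3)) s, dist (g (F z₀)) (y i) ≤ 4885 / 2000 →
      dist z z₀ = 1 → dist z' z₀ = 1 → ‖F (z - z₀)‖ ≤ 2007 / 2000 * ‖F (z' - z₀)‖ := by
    intro z₀ hz₀ z hz z' hz' hd h1z h1z'
    by_contra hlt
    push Not at hlt
    exact hcon (Or.inl ⟨z₀, hz₀, z, hz, z', hz', hd, h1z, h1z', hlt⟩)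
  have hB : ∀ j : Fin N, dist (y j) (y i) ≤ 4885 / 2000 →
      ∃ z ∈ barlowStacking 1 (Real.sqrt (2 / 3)) s, dist (y j) (g (F z)) < 977 / 5000000 := by
    intro j hj
    by_contra hno
    push Not at hno
    exact hcon (Or.inr ⟨j, hj, hno⟩)
  apply hch
  -- distances in the strained reference
  have hΦd : ∀ z w : EuclideanSpace ℝ (Fin 3), dist (g (F z)) (g (F w)) = ‖F (z - w)‖ := by
    intro z w
    rw [g.dist_map, dist_eq_norm, map_sub]
  have hD := h1 s F hs hF
  set S := barlowStacking 1 (Real.sqrt (2 / 3)) s with hSdef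
  -- injectivity of the reference map on `S`
  have hinj : Set.InjOn (fun z => g (F z)) S := by
    intro z hz w hw heq
    have heq' : g (F z) = g (F w) := heq
    by_contra hne
    have h := (hD w hw).1 z hz hne
    have h0 : ‖F (z - w)‖ = 0 := by rw [← hΦd, heq', dist_self]
    linarith
  refine h2 N y i ((fun z => g (F z)) '' S) ?_ ?_ ?_ ?_ ?_ hsep ?_ ?_
  · rintro _ ⟨z, hz, rfl⟩ _ ⟨w, hw, rfl⟩ hne
    have hzw : z ≠ w := fun h => hne (by rw [h])
    rw [hΦd]
    exact (hD w hw).1 z hz hzw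
  · rintro _ ⟨z₀, hz₀, rfl⟩ _ ⟨z, hz, rfl⟩ hne hd
    have hzne : z ≠ z₀ := fun h => hne (by rw [h])
    rw [hΦd] at hd ⊢
    exact ((hD z₀ hz₀).2.1 z hz hzne hd).2
  · rintro _ ⟨z₀, hz₀, rfl⟩
    have hset : {x ∈ (fun z => g (F z)) '' S | x ≠ g (F z₀) ∧ dist x (g (F z₀)) < 1231 / 1000} =
        (fun z => g (F z)) '' {z ∈ S | z ≠ z₀ ∧ ‖F (z - z₀)‖ < 1231 / 1000} := by
      ext x
      constructor
      · rintro ⟨⟨z, hz, rfl⟩, hne, hd⟩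
        exact ⟨z, ⟨hz, fun h => hne (by rw [h]), by rwa [hΦd] at hd⟩, rfl⟩
      · rintro ⟨z, ⟨hz, hne, hd⟩, rfl⟩
        refine ⟨⟨z, hz, rfl⟩, fun heq => hne (hinj hz hz₀ heq), ?_⟩
        show dist (g (F z)) (g (F z₀)) < 1231 / 1000
        rwa [hΦd]
    rw [hset, (hinj.mono fun z hz => hz.1).ncard_image]
    exact (hD z₀ hz₀).2.2.1
  · rintro _ ⟨z₀, hz₀, rfl⟩ _ ⟨z, hz, rfl⟩ hne hd
    have hzne : z ≠ z₀ := fun h => hne (by rw [h])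
    rw [hΦd] at hd
    have hset : {x ∈ (fun z => g (F z)) '' S | x ≠ g (F z₀) ∧ x ≠ g (F z) ∧
        dist x (g (F z₀)) < 1231 / 1000 ∧ dist x (g (F z)) < 1231 / 1000} =
        (fun z => g (F z)) '' {w ∈ S | w ≠ z₀ ∧ w ≠ z ∧ ‖F (w - z₀)‖ < 1231 / 1000 ∧
          ‖F (w - z)‖ < 1231 / 1000} := by
      ext x
      constructor
      · rintro ⟨⟨w, hw, rfl⟩, hne₀, hne₁, hd₀, hd₁⟩
        exact ⟨w, ⟨hw, fun h => hne₀ (by rw [h]), fun h => hne₁ (by rw [h]), by rwa [hΦd] at hd₀,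
          by rwa [hΦd] at hd₁⟩, rfl⟩
      · rintro ⟨w, ⟨hw, hne₀, hne₁, hd₀, hd₁⟩, rfl⟩
        refine ⟨⟨w, hw, rfl⟩, fun heq => hne₀ (hinj hw hz₀ heq), fun heq => hne₁ (hinj hw hz heq),
          ?_, ?_⟩
        · show dist (g (F w)) (g (F z₀)) < 1231 / 1000
          rwa [hΦd]
        · show dist (g (F w)) (g (F z)) < 1231 / 1000
          rwa [hΦd]
    rw [hset, (hinj.mono fun w hw => hw.1).ncard_image]
    exact (hD z₀ hz₀).2.2.2 z hz hzne hd
  · rintro _ ⟨z₀, hz₀, rfl⟩ hd _ ⟨z, hz, rfl⟩ _ ⟨z', hz', rfl⟩ hne hne' hdz hdz'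
    have hzne : z ≠ z₀ := fun h => hne (by rw [h])
    have hzne' : z' ≠ z₀ := fun h => hne' (by rw [h])
    rw [hΦd] at hdz hdz' ⊢
    rw [hΦd]
    exact hA z₀ hz₀ z hz z' hz' hd ((hD z₀ hz₀).2.1 z hz hzne hdz).1
      ((hD z₀ hz₀).2.1 z' hz' hzne' hdz').1
  · rintro _ ⟨z, hz, rfl⟩ hd
    exact hM2 z hz hd
  · intro j hj
    obtain ⟨z, hz, hd⟩ := hB j hj
    exact ⟨g (F z), ⟨z, hz, rfl⟩, hd⟩

/-- **THRESH `ChargedNearSiteDeviates` HOLDS** (sorry-free: T1 p173403 + T2 p173397 + the glue). -/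
theorem chargedNearSiteDeviates_holds : ChargedNearSiteDeviates :=
  chargedNearSiteDeviates_of stub_strainedLinkDictionary stub_ratioGermEngine

/-- **LNP₂ ⇒ NEAR₂′** (reshape r1, proved): the landed `near_pricing_assembly` (p169781) with `P :=` the
near₂ predicate — only its separation clause, `a = 977/1000`, is used — and `Ch := ¬ IsChargeFree (1/100) y`,
`e_χ* ≤ 0` by `iInf_energyPerParticle_truncLJ_nonpos`. -/
theorem nearChargePricing'_of_localNearPricing₂ (h : LocalNearPricing₂) : NearChargePricing' := by
  obtain ⟨κ, C, ρ, hκ, Φ, hΦ1, hΦ2, hΦ3⟩ := h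
  refine ⟨κ, (κ + 37 + max C 0) * (400 * max ρ 0 / 93 + 1) ^ 3 + max C 0 + 205, hκ,
    fun N y hy S hS => ?_⟩
  exact near_pricing_assembly y hy _ _ S hS
    (fun i hi => by
      obtain ⟨s, F, g, -, -, hs, -, -⟩ := hi
      refine ⟨977 / 1000, by norm_num, fun j k hjk hj => ?_⟩
      have h := hs j k hjk (by linarith)
      linarith)
    _ κ C ρ iInf_energyPerParticle_truncLJ_nonpos hκ.le (Φ N y) (hΦ1 N y hy)
    (fun i => hΦ2 N y i hy) (fun i hi => hΦ3 N y i hy hi)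

/-- **NEAR₂′ ⇒ NEAR₂** (reshape r1, proved): instantiate the `Finset` with the filter of the near₂
predicate. -/
theorem nearChargePricing_of_prime (h : NearChargePricing') : NearChargePricing := by
  obtain ⟨κ, C, hκ, h⟩ := h
  refine ⟨κ, max C 0, hκ, fun N y hy => ?_⟩
  set S : Finset (Fin N) := Finset.univ.filter fun i => ∃ (s : ℤ → ℤ) (F : EuclideanSpace ℝ (Fin 3) →L[ℝ] EuclideanSpace ℝ (Fin 3)) (g : EuclideanSpace ℝ (Fin 3) ≃ᵃⁱ[ℝ] EuclideanSpace ℝ (Fin 3)), Literature.MathematicalPhysics.StatisticalMechanics.IsHaggSeq s ∧ (∀ v : EuclideanSpace ℝ (Fin 3), ‖F v - (977 / 1000 : ℝ) • v‖ ≤ 977 / 10000 * ‖v‖) ∧ (∀ j k : Fin N, j ≠ k → dist (y j) (y i) ≤ 2931 / 1000 → 977 / 2000 ≤ dist (y j) (y k)) ∧ (∀ j : Fin N, dist (y j) (y i) ≤ 2931 / 1000 → ∃ z ∈ Literature.MathematicalPhysics.StatisticalMechanics.barlowStacking 1 (Real.sqrt (2 / 3)) s, dist (y j) (g (F z)) ≤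 977 / 8000) ∧ (∀ z ∈ Literature.MathematicalPhysics.StatisticalMechanics.barlowStacking 1 (Real.sqrt (2 / 3)) s, dist (g (F z)) (y i) ≤ 2931 / 1000 → ∃ j : Fin N, dist (y j) (g (F z)) ≤ 977 / 8000) with hS
  have hmem : ∀ i : Fin N, i ∈ S ↔ ∃ (s : ℤ → ℤ) (F : EuclideanSpace ℝ (Fin 3) →L[ℝ] EuclideanSpace ℝ (Fin 3)) (g : EuclideanSpace ℝ (Fin 3) ≃ᵃⁱ[ℝ] EuclideanSpace ℝ (Fin 3)), Literature.MathematicalPhysics.StatisticalMechanics.IsHaggSeq s ∧ (∀ v : EuclideanSpace ℝ (Fin 3), ‖F v - (977 / 1000 : ℝ) • v‖ ≤ 977 / 10000 * ‖v‖) ∧ (∀ j k : Fin N, j ≠ k → dist (y j) (y i) ≤ 2931 / 1000 → 977 / 2000 ≤ dist (y j) (y k)) ∧ (∀ j : Fin N, dist (y j) (y i) ≤ 2931 / 1000 → ∃ z ∈ Literature.MathematicalPhysics.StatisticalMechanics.barlowStacking 1 (Real.sqrt (2 / 3)) s, dist (y j) (g (F z)) ≤ 977 / 8000) ∧ (∀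 z ∈ Literature.MathematicalPhysics.StatisticalMechanics.barlowStacking 1 (Real.sqrt (2 / 3)) s, dist (g (F z)) (y i) ≤ 2931 / 1000 → ∃ j : Fin N, dist (y j) (g (F z)) ≤ 977 / 8000) := fun i => by
    rw [hS, Finset.mem_filter]; simp
  have h1 := h N y hy S hmem
  have e1 : (Nat.card {i : Fin N // ¬ Literature.Geometry.DiscreteGeometry.IsChargeFree (1 / 100 : ℝ) y i ∧ i ∈ S} : ℝ) =
      (Nat.card {i : Fin N // ¬ Literature.Geometry.DiscreteGeometry.IsChargeFree (1 / 100 : ℝ) y i ∧ ∃ (s : ℤ → ℤ) (F : EuclideanSpace ℝ (Fin 3) →L[ℝ] EuclideanSpace ℝ (Fin 3)) (g : EuclideanSpace ℝ (Fin 3) ≃ᵃⁱ[ℝ] EuclideanSpace ℝ (Fin 3)), Literature.MathematicalPhysics.StatisticalMechanics.IsHaggSeq s ∧ (∀ v : EuclideanSpace ℝ (Fin 3), ‖F v - (977 / 1000 : ℝ) • v‖ ≤ 977 / 10000 * ‖v‖) ∧ (∀ j k : Fin N, j ≠ k → dist (y j) (y i) ≤ 2931 / 1000 → 977 / 2000 ≤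 dist (y j) (y k)) ∧ (∀ j : Fin N, dist (y j) (y i) ≤ 2931 / 1000 → ∃ z ∈ Literature.MathematicalPhysics.StatisticalMechanics.barlowStacking 1 (Real.sqrt (2 / 3)) s, dist (y j) (g (F z)) ≤ 977 / 8000) ∧ (∀ z ∈ Literature.MathematicalPhysics.StatisticalMechanics.barlowStacking 1 (Real.sqrt (2 / 3)) s, dist (g (F z)) (y i) ≤ 2931 / 1000 → ∃ j : Fin N, dist (y j) (g (F z)) ≤ 977 / 8000)} : ℝ) := by
    congr 1
    exact Nat.card_congr (Equiv.subtypeEquivRight fun i => by rw [hmem])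
  have e2 : ((Finset.univ \ S).card : ℝ) = (Nat.card {i : Fin N // ¬ ∃ (s : ℤ → ℤ) (F : EuclideanSpace ℝ (Fin 3) →L[ℝ] EuclideanSpace ℝ (Fin 3)) (g : EuclideanSpace ℝ (Fin 3) ≃ᵃⁱ[ℝ] EuclideanSpace ℝ (Fin 3)), Literature.MathematicalPhysics.StatisticalMechanics.IsHaggSeq s ∧ (∀ v : EuclideanSpace ℝ (Fin 3), ‖F v - (977 / 1000 : ℝ) • v‖ ≤ 977 / 10000 * ‖v‖) ∧ (∀ j k : Fin N, j ≠ k → dist (y j) (y i) ≤ 2931 / 1000 → 977 / 2000 ≤ dist (y j) (y k)) ∧ (∀ j : Fin N, dist (y j) (y i) ≤ 2931 / 1000 → ∃ z ∈ Literature.MathematicalPhysics.StatisticalMechanics.barlowStacking 1 (Real.sqrt (2 / 3)) s, dist (y j) (g (F z)) ≤ 977 / 8000) ∧ (∀ z ∈ Literature.MathematicalPhysics.StatisticalMechanics.barlowStacking 1 (Real.sqrt (2 / 3)) s, dist (g (F z)) (y i) ≤ 2931 / 1000 → ∃ j : Fin N, dist (y j) (g (F z)) ≤ 977 / 8000)}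 : ℝ) := by
    rw [Nat.card_eq_fintype_card, Fintype.card_subtype]
    congr 1
    congr 1
    ext i
    simp only [Finset.mem_sdiff, Finset.mem_univ, true_and, Finset.mem_filter]
    rw [hmem]
  rw [e1, e2] at h1
  have hc : C * (Nat.card {i : Fin N // ¬ ∃ (s : ℤ → ℤ) (F : EuclideanSpace ℝ (Fin 3) →L[ℝ] EuclideanSpace ℝ (Fin 3)) (g : EuclideanSpace ℝ (Fin 3) ≃ᵃⁱ[ℝ] EuclideanSpace ℝ (Fin 3)), Literature.MathematicalPhysics.StatisticalMechanics.IsHaggSeq s ∧ (∀ v : EuclideanSpace ℝ (Fin 3), ‖F v - (977 / 1000 : ℝ) • v‖ ≤ 977 / 10000 * ‖v‖) ∧ (∀ j k : Fin N, j ≠ k → dist (y j) (y i) ≤ 2931 / 1000 → 977 / 2000 ≤ dist (y j) (y k)) ∧ (∀ j : Fin N, dist (y j) (y i) ≤ 2931 / 1000 → ∃ z ∈ Literature.MathematicalPhysics.StatisticalMechanics.barlowStacking 1 (Real.sqrt (2 / 3)) s, dist (y j) (g (F z)) ≤ 977 / 8000) ∧ (∀ z ∈ Literature.MathematicalPhysics.StatisticalMechanics.barlowStacking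 1 (Real.sqrt (2 / 3)) s, dist (g (F z)) (y i) ≤ 2931 / 1000 → ∃ j : Fin N, dist (y j) (g (F z)) ≤ 977 / 8000)} : ℝ) ≤ max C 0 * (Nat.card {i : Fin N // ¬ ∃ (s : ℤ → ℤ) (F : EuclideanSpace ℝ (Fin 3) →L[ℝ] EuclideanSpace ℝ (Fin 3)) (g : EuclideanSpace ℝ (Fin 3) ≃ᵃⁱ[ℝ] EuclideanSpace ℝ (Fin 3)), Literature.MathematicalPhysics.StatisticalMechanics.IsHaggSeq s ∧ (∀ v : EuclideanSpace ℝ (Fin 3), ‖F v - (977 / 1000 : ℝ) • v‖ ≤ 977 / 10000 * ‖v‖) ∧ (∀ j k : Fin N, j ≠ k → dist (y j) (y i) ≤ 2931 / 1000 → 977 / 2000 ≤ dist (y j) (y k)) ∧ (∀ j : Fin N, dist (y j) (y i) ≤ 2931 / 1000 → ∃ z ∈ Literature.MathematicalPhysics.StatisticalMechanics.barlowStacking 1 (Real.sqrt (2 / 3)) s, dist (y j) (g (F z)) ≤ 977 / 8000) ∧ (∀ z ∈ Literature.MathematicalPhysics.StatisticalMechanics.barlowStacking 1 (Real.sqrt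 (2 / 3)) s, dist (g (F z)) (y i) ≤ 2931 / 1000 → ∃ j : Fin N, dist (y j) (g (F z)) ≤ 977 / 8000)} : ℝ) :=
    mul_le_mul_of_nonneg_right (le_max_left _ _) (Nat.cast_nonneg _)
  linarith

/-- **The elastic-basin glue — LANDED** (p173395, `…ElasticBasinSplit.lean`, Theorems namespace, inlined
statements): FAR₂ and NEAR₂ give the crux with `κ := κ₁κ₂/(κ₁ + κ₂ + max C 0)`.  Invoked here on the named
Props (they unfold to the inlined texts); kept as an `example` so that exactly ONE theorem of this file
concludes the crux by name (`TruncatedCensusGap_of`). -/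
example (hFar' : DefectFarSiteGap) (hNear' : NearChargePricing) : TruncatedCensusGap :=
  Theorems.PricedLinkCensusTruncatedCensusGap.truncatedCensusGap_of_elasticBasinSplit hFar' hNear'


/-- **`TruncatedCensusGap_of`** — the two remaining registered stubs give the crux BY NAME (reshape r1 after
wave 1): THRESH := T1 + T2 (both LANDED, `chargedNearSiteDeviates_holds`), LNP₂ := ENGINE₂′ THRESH,
NEAR₂ := NEAR₂′ ⇐ LNP₂, then the elastic-basin glue with FAR₂. -/
theorem TruncatedCensusGap_of (h₁ : Registered.stub_defectFarSiteGap)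
    (h₄ : Registered.stub_localPricingEngine) : TruncatedCensusGap :=
  Theorems.PricedLinkCensusTruncatedCensusGap.truncatedCensusGap_of_elasticBasinSplit h₁
    (nearChargePricing_of_prime (nearChargePricing'_of_localNearPricing₂
      (h₄ chargedNearSiteDeviates_holds)))

/-- Wiring check: the registered stubs feed `TruncatedCensusGap_of` as stated. -/
example : TruncatedCensusGap :=
  TruncatedCensusGap_of stub_defectFarSiteGap stub_localPricingEngine

/-- **THE CRUX MODULO ITS TWO OPEN CORES at the elastic-basin cut** (LANDED p173395 as
`truncatedCensusGap_of_defectFar_of_localNearPricing2`): `TruncatedCensusGap` follows from FAR₂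
(`DefectFarSiteGap`) and LNP₂ (`LocalNearPricing₂`); the bookkeeping in between is PROVED. -/
example (hFar : DefectFarSiteGap) (hLNP : LocalNearPricing₂) : TruncatedCensusGap :=
  Theorems.PricedLinkCensusTruncatedCensusGap.truncatedCensusGap_of_defectFar_of_localNearPricing2 hFar hLNP

/-! ## §5 Calibration (sorry-free): NEAR₂ is a genuine, strictly weaker piece of the crux -/

/-- The crux implies NEAR₂ (allowance `C = 0`: a charged-and-near₂ site is charged). -/
theorem nearChargePricing_of_truncatedCensusGap (h : TruncatedCensusGap) : NearChargePricing := by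
  obtain ⟨κ, hκ, h⟩ := h
  refine ⟨κ, 0, hκ, fun N y hy => ?_⟩
  have h1 := h N y hy
  rw [zero_mul, add_zero]
  refine le_trans ?_ h1
  have hle := Nat.card_le_card_of_injective _
    (Subtype.impEmbedding
      (fun i : Fin N => ¬ Literature.Geometry.DiscreteGeometry.IsChargeFree (1 / 100 : ℝ) y i ∧ ∃ (s : ℤ → ℤ) (F : EuclideanSpace ℝ (Fin 3) →L[ℝ] EuclideanSpace ℝ (Fin 3)) (g : EuclideanSpace ℝ (Fin 3) ≃ᵃⁱ[ℝ] EuclideanSpace ℝ (Fin 3)), Literature.MathematicalPhysics.StatisticalMechanics.IsHaggSeq s ∧ (∀ v : EuclideanSpace ℝ (Fin 3), ‖F v - (977 / 1000 : ℝ) • v‖ ≤ 977 / 10000 * ‖v‖) ∧ (∀ j k : Fin N, j ≠ k → dist (y j) (y i) ≤ 2931 / 1000 → 977 / 2000 ≤ dist (y j) (y k)) ∧ (∀ j : Fin N, dist (y j) (y i) ≤ 2931 / 1000 → ∃ z ∈ Literature.MathematicalPhysics.StatisticalMechanics.barlowStacking 1 (Real.sqrt (2 / 3)) s, dist (y j)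 (g (F z)) ≤ 977 / 8000) ∧ (∀ z ∈ Literature.MathematicalPhysics.StatisticalMechanics.barlowStacking 1 (Real.sqrt (2 / 3)) s, dist (g (F z)) (y i) ≤ 2931 / 1000 → ∃ j : Fin N, dist (y j) (g (F z)) ≤ 977 / 8000))
      (fun i : Fin N => ¬ Literature.Geometry.DiscreteGeometry.IsChargeFree (1 / 100 : ℝ) y i) fun i hi => hi.1).injective
  have hcast := (Nat.cast_le (α := ℝ)).mpr hle
  have hle' := mul_le_mul_of_nonneg_left hcast hκ.le
  linarith

end Summit.AtomisticToContinuum.Crystallization.Cruxes.TruncatedCensusGap.ElasticBasinSplit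

end
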